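import Literature.NumberTheory.Sieve.ParityWave0BombieriVinogradovProofs
import Literature.NumberTheory.Sieve.BombieriVinogradovReduction
import Literature.NumberTheory.LFunctions.PrimeNumberTheoremErrorTermProofs
import HarnessLib

/-!
# parity.S29 — the Motohashi–Pintz–Zhang property `MPZ[ϖ, δ]`: API and its Bombieri–Vinogradov range

Topic `Literature/NumberTheory/Sieve`; sibling proofs file of `ParityWave0.lean` for the predicate
`Literature.NumberTheory.Sieve.MPZ` and the named fact `Literature.NumberTheory.Sieve.mpz_of_lt`
(**parity.S29**: `MPZ[ϖ, δ]` for all `ϖ, δ > 0` with `600ϖ + 180δ < 7` — D. H. J. Polymath, *New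
equidistribution estimates of Zhang type*, Algebra & Number Theory 8:9 (2014) 2067–2199 =
arXiv:1402.0811, Claim 2.3 and Theorem 2.4(i); the case `ϖ = δ = 1/1168` with tuple-tied residues is
Zhang, Ann. of Math. 179 (2014), Theorem 2).

Nothing here discharges `mpz_of_lt`: its printed proof (Polymath 8a §§3–8: the Heath-Brown identity
reduction Lemma 2.7 to the Type I/II/III estimates of Theorem 2.8, Linnik's dispersion method, and —
for the Type I estimate (iii) and the Type III estimate, hence for the full range `600ϖ + 180δ < 7` —
"Deligne's deepest form of the Riemann Hypothesis over finite fields", op. cit. p. 3) is a theory absent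
from Mathlib and from this tree.  What this file PROVES is the elementary structure of the predicate and
its provable shadow below level `1/2`:

* `MPZ.mono`: `MPZ[ϖ, δ]` is downward monotone in the level exponent `ϖ` (a sub-sum of nonnegative
  terms);
* `MPZ.mono_delta`: `MPZ[ϖ, δ]` is downward monotone in the smoothness exponent `δ` — not a sub-sum
  (the hypothesis on the residue `a` weakens with `δ`), but the Chinese remainder theorem moves `a` to
  a residue `a' ≡ a (mod ∏_{p ≤ x^{δ'}} p)` coprime to the primes in `(x^{δ'}, x^δ]` without changing
  any summand (Polymath 8a, §2.1, the remark after Theorem 2.4: "Using … the Chinese Remainder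
  Theorem");
* `mpz_of_neg_of_bombieri_vinogradov`, `mpz_of_neg`: **`MPZ[ϖ, δ]` holds for every `ϖ < 0` and every
  `δ`** — the Bombieri–Vinogradov range (level `x^{1/2+2ϖ} ≤ x^{1/2} (log x)^{-B}` eventually), from
  parity.S27 `bombieri_vinogradov`, which is PROVED in the tree (`bombieri_vinogradov_holds`,
  `ParityWave0BombieriVinogradovProofs.lean`).  This is the exact analogue for S29 of
  `eh_of_bombieri_vinogradov` (S25) and isolates what is deep in `mpz_of_lt`: any single `ϖ ≥ 0`
  (Polymath 8a, §1: Zhang's estimate has "the crucial feature of going beyond the range accessible to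
  the Bombieri–Vinogradov technique", where "only smooth moduli were involved");
  `mpz_of_lt_iff_forall` records that, given the Bombieri–Vinogradov range, the hypothesis `0 < ϖ`
  in `mpz_of_lt` is redundant;
* `MPZ_iff_coprimeMean`: the vendored main term `x/φ(q)` may be replaced by the printed coprime mean
  `(1/φ(q)) ∑_{x < n ≤ 2x, (n,q)=1} Λ(n)` of Polymath's discrepancy `Δ(Λ 1_{[x,2x]}; a (q))`
  (faithfulness of the vendored form), the difference being admissible by the prime number theorem
  with the de la Vallée Poussin error term (`ChebyshevPsiDeLaValleePoussin_holds`, PROVED in the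
  tree), `∑_{q ≤ Q} 1/φ(q) ≤ (1 + log Q)²` (`totientInvSum_le`) and the bound `nonCoprimePart_le` for
  the prime powers `p^k`, `p ∣ q` (`MPZ.sum_abs_mainTerm_sub_le`).

## References

* D. H. J. Polymath, *New equidistribution estimates of Zhang type*, Algebra Number Theory 8 (2014),
  2067–2199, arXiv:1402.0811: Claim 2.3 (`MPZ^{(i)}[ϖ, δ]`), Theorem 2.4, Lemma 2.10(iii), Theorem 2.9
  (Bombieri–Vinogradov). [cite: Polymath8a2014]
* Y. Zhang, *Bounded gaps between primes*, Ann. of Math. 179 (2014), 1121–1174, Theorem 2.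
  [cite: ZhangAnnals2014]
* E. Bombieri, *On the large sieve*, Mathematika 12 (1965), 201–225. [cite: Bombieri1965]
-/

open Filter Asymptotics Finset
open scoped ArithmeticFunction.vonMangoldt

namespace Literature.NumberTheory.Sieve

/-! ### Elementary bounds for `ψ(x; q, a)` -/

/-- `ψ(y; q, a)` is monotone in `y` (a longer sum of nonnegative terms). [folklore] -/
theorem MPZ.chebyshevPsiMod_mono (q : ℕ) (a : ZMod q) {y y' : ℝ} (h : y ≤ y') :
    ParityWave0.chebyshevPsiMod q a y ≤ ParityWave0.chebyshevPsiMod q a y' :=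
  Finset.sum_le_sum_of_subset_of_nonneg
    (Finset.range_mono (Nat.succ_le_succ (Nat.floor_le_floor h)))
    fun n _ _ => ArithmeticFunction.vonMangoldt.residueClass_nonneg a n

/-- `ψ(y; q, a) ≤ ψ(y)` (drop the congruence condition). [folklore] -/
theorem MPZ.chebyshevPsiMod_le_psi (q : ℕ) (a : ZMod q) (y : ℝ) :
    ParityWave0.chebyshevPsiMod q a y ≤ Chebyshev.psi y := by
  rw [ParityWave0.chebyshevPsiMod, Chebyshev.psi_eq_sum_Icc, Nat.range_succ_eq_Icc_zero]
  exact Finset.sum_le_sum fun n _ => ArithmeticFunction.vonMangoldt.residueClass_le a n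

/-- **Trivial bound for one summand of `MPZ`**: for `q ≥ 1` and `x ≥ 0`,
`|ψ(2x; q, a) − ψ(x; q, a) − x/φ(q)| ≤ 15 x`, from `0 ≤ ψ(x; q, a) ≤ ψ(2x; q, a) ≤ ψ(2x) ≤
(log 4 + 4) · 2x` (Chebyshev, Mathlib's `Chebyshev.psi_le_const_mul_self`) and `0 ≤ x/φ(q) ≤ x`.
[folklore] -/
theorem MPZ.abs_summand_le {q : ℕ} (hq : 1 ≤ q) (a : ZMod q) {x : ℝ} (hx : 0 ≤ x) :
    |ParityWave0.chebyshevPsiMod q a (2 * x) - ParityWave0.chebyshevPsiMod q a x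
        - x / Nat.totient q| ≤ 15 * x := by
  have h1 : 0 ≤ ParityWave0.chebyshevPsiMod q a x :=
    Finset.sum_nonneg fun n _ => ArithmeticFunction.vonMangoldt.residueClass_nonneg a n
  have h2 : ParityWave0.chebyshevPsiMod q a x ≤ ParityWave0.chebyshevPsiMod q a (2 * x) :=
    MPZ.chebyshevPsiMod_mono q a (by linarith)
  have h3 : ParityWave0.chebyshevPsiMod q a (2 * x) ≤ (Real.log 4 + 4) * (2 * x) :=
    (MPZ.chebyshevPsiMod_le_psi q a _).trans (Chebyshev.psi_le_const_mul_self (by linarith))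
  have h4 : Real.log 4 ≤ 3 := by
    have := Real.log_le_sub_one_of_pos (by norm_num : (0 : ℝ) < 4)
    linarith
  have h5 : (Real.log 4 + 4) * (2 * x) ≤ 7 * (2 * x) :=
    mul_le_mul_of_nonneg_right (by linarith) (by linarith)
  have hφ : (1 : ℝ) ≤ Nat.totient q := by exact_mod_cast Nat.totient_pos.mpr hq
  have h6 : 0 ≤ x / Nat.totient q := div_nonneg hx (by linarith)
  have h7 : x / Nat.totient q ≤ x := div_le_self hx hφ
  rw [abs_le]
  constructor <;> linarith

/-! ### Coprimality of the residue and reduced residues -/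

/-- If no prime `p ≤ N` divides `a` and every prime factor of `q` is `≤ N` (Mathlib:
`q ∈ Nat.smoothNumbers (N + 1)`), then `a` is coprime to `q`. [folklore] -/
theorem MPZ.isCoprime_of_smooth {a : ℤ} {N q : ℕ}
    (ha : ∀ p : ℕ, p.Prime → p ≤ N → ¬(p : ℤ) ∣ a) (hq : q ∈ Nat.smoothNumbers (N + 1)) :
    IsCoprime a (q : ℤ) := by
  have hqa : Nat.Coprime q a.natAbs := by
    refine Nat.coprime_of_dvd fun p hp hpq hpa => ?_
    have hpN : p ≤ N := Nat.lt_succ_iff.mp ((Nat.mem_smoothNumbers'.mp hq) p hp hpq)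
    exact ha p hp hpN (Int.natCast_dvd.mpr hpa)
  rw [Int.isCoprime_iff_nat_coprime, Int.natAbs_natCast]
  exact hqa.symm

/-- For `(a, q) = 1`, the discrepancy of the class `a (mod q)` is at most the maximum over
reduced classes: `|ψ(y; q, a) − z| ≤ max_{(b,q)=1} |ψ(y; q, b) − z|`. [folklore] -/
theorem MPZ.abs_sub_le_iSup {q : ℕ} {a : ℤ} (ha : IsCoprime a (q : ℤ)) (y z : ℝ) :
    |ParityWave0.chebyshevPsiMod q (a : ZMod q) y - z| ≤
      ⨆ b : (ZMod q)ˣ, |ParityWave0.chebyshevPsiMod q (b : ZMod q) y - z| := by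
  have hbdd : BddAbove (Set.range fun b : (ZMod q)ˣ =>
      |ParityWave0.chebyshevPsiMod q (b : ZMod q) y - z|) := (Set.finite_range _).bddAbove
  have h := le_ciSup hbdd (ZMod.unitOfIsCoprime a ha)
  simpa only [ZMod.coe_unitOfIsCoprime] using h

/-! ### Monotonicity of `MPZ[ϖ, δ]` -/

/-- **`MPZ[ϖ, δ]` is downward monotone in `ϖ`**: for `ϖ' ≤ ϖ` the moduli `q ≤ x^{1/2 + 2ϖ'}` form a
sub-range of `q ≤ x^{1/2 + 2ϖ}` (`x ≥ 2`) and every summand is nonnegative (immediate from Claim 2.3;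
cf. `EH.mono`). [cite: Polymath8a2014, Claim 2.3] -/
theorem MPZ.mono {ϖ ϖ' δ : ℝ} (h : MPZ ϖ δ) (hϖ : ϖ' ≤ ϖ) : MPZ ϖ' δ := by
  intro A
  obtain ⟨C, hC⟩ := h A
  refine ⟨C, fun x hx a ha => le_trans ?_ (hC x hx a ha)⟩
  refine Finset.sum_le_sum_of_subset_of_nonneg (Finset.filter_subset_filter _
    (Finset.Icc_subset_Icc le_rfl (Nat.floor_le_floor ?_))) fun q _ _ => abs_nonneg _
  exact Real.rpow_le_rpow_of_exponent_le (by linarith) (by linarith)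

/-- **`MPZ[ϖ, δ]` is downward monotone in `δ`.**  For `δ' ≤ δ` the `x^{δ'}`-smooth moduli are
`x^δ`-smooth, but a residue `a` coprime to the primes `p ≤ x^{δ'}` need not be admissible for
`MPZ[ϖ, δ]`; by the Chinese remainder theorem there is `a' ≡ a (mod ∏_{p ≤ x^{δ'}} p)` with
`a' ≡ 1 (mod p)` for the primes `x^{δ'} < p ≤ x^δ`, which is admissible and has the same summands
`ψ(·; q, a') = ψ(·; q, a)` for every squarefree `x^{δ'}`-smooth `q` (such `q` divide
`∏_{p ≤ x^{δ'}} p`).  (Cf. Polymath 8a, §2.1, remark after Theorem 2.4, where "the Chinese Remainder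
Theorem" passes from one residue coprime to `P_I` to a system of residues `(a_q)`.) [cite: Polymath8a2014, Claim 2.3 and the remark after Theorem 2.4] -/
theorem MPZ.mono_delta {ϖ δ δ' : ℝ} (h : MPZ ϖ δ) (hδ : δ' ≤ δ) : MPZ ϖ δ' := by
  intro A
  obtain ⟨C, hC⟩ := h A
  refine ⟨C, fun x hx a ha => ?_⟩
  -- notation
  set N' : ℕ := ⌊x ^ δ'⌋₊ with hN'
  set N : ℕ := ⌊x ^ δ⌋₊ with hN
  have hNN : N' ≤ N := Nat.floor_le_floor (Real.rpow_le_rpow_of_exponent_le (by linarith) hδ)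
  -- the two blocks of primes and their products
  set s₁ : Finset ℕ := (Finset.range (N' + 1)).filter Nat.Prime with hs₁
  set s₂ : Finset ℕ := (Finset.Ioc N' N).filter Nat.Prime with hs₂
  have hs₁p : ∀ p ∈ s₁, p.Prime := fun p hp => (Finset.mem_filter.mp hp).2
  have hs₂p : ∀ p ∈ s₂, p.Prime := fun p hp => (Finset.mem_filter.mp hp).2
  set P₁ : ℕ := ∏ p ∈ s₁, p with hP₁
  set P₂ : ℕ := ∏ p ∈ s₂, p with hP₂
  have hP₁pos : 0 < P₁ := Finset.prod_pos fun p hp => (hs₁p p hp).pos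
  have hcop : Nat.Coprime P₁ P₂ := by
    refine Nat.Coprime.prod_left fun p hp => Nat.Coprime.prod_right fun r hr => ?_
    refine (Nat.coprime_primes (hs₁p p hp) (hs₂p r hr)).mpr fun hpr => ?_
    have h1 : p < N' + 1 := Finset.mem_range.mp (Finset.mem_filter.mp hp).1
    have h2 : N' < r := (Finset.mem_Ioc.mp (Finset.mem_filter.mp hr).1).1
    omega
  -- the Chinese remainder residue
  set a₀ : ℕ := (a % (P₁ : ℤ)).toNat with ha₀
  have ha₀a : (a₀ : ℤ) ≡ a [ZMOD (P₁ : ℤ)] := by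
    rw [ha₀, Int.toNat_of_nonneg (Int.emod_nonneg a (by exact_mod_cast hP₁pos.ne'))]
    exact Int.mod_modEq a _
  obtain ⟨k, hk₁, hk₂⟩ := Nat.chineseRemainder hcop a₀ 1
  have hka : (k : ℤ) ≡ a [ZMOD (P₁ : ℤ)] := (Int.natCast_modEq_iff.mpr hk₁).trans ha₀a
  -- `k` is admissible for `MPZ[ϖ, δ]`
  have hk : ∀ p : ℕ, p.Prime → p ≤ N → ¬(p : ℤ) ∣ (k : ℤ) := by
    intro p hp hpN hpk
    rcases le_or_gt p N' with hpN' | hpN'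
    · -- `p ∣ P₁`, `k ≡ a (mod p)`, so `p ∣ a`
      have hp1 : p ∈ s₁ := Finset.mem_filter.mpr ⟨Finset.mem_range.mpr (Nat.lt_succ_of_le hpN'), hp⟩
      have hpP : (p : ℤ) ∣ (P₁ : ℤ) := Int.natCast_dvd_natCast.mpr (Finset.dvd_prod_of_mem _ hp1)
      have hkap : (k : ℤ) ≡ a [ZMOD (p : ℤ)] := hka.of_dvd hpP
      have hpa : (p : ℤ) ∣ a := by
        have := (Int.ModEq.dvd hkap.symm)  -- p ∣ k - a ... check direction
        have h' : (p : ℤ) ∣ (k : ℤ) - ((k : ℤ) - a) := dvd_sub hpk this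
        simpa using h'
      exact ha p hp hpN' hpa
    · -- `p ∣ P₂`, `k ≡ 1 (mod p)`, so `p ∣ 1`
      have hp2 : p ∈ s₂ := Finset.mem_filter.mpr ⟨Finset.mem_Ioc.mpr ⟨hpN', hpN⟩, hp⟩
      have hk1 : k ≡ 1 [MOD p] := hk₂.of_dvd (Finset.dvd_prod_of_mem _ hp2)
      have hpk' : p ∣ k := Int.natCast_dvd_natCast.mp hpk
      have h01 : 0 ≡ 1 [MOD p] := ((Nat.modEq_zero_iff_dvd.mpr hpk').symm).trans hk1
      exact hp.one_lt.ne' (Nat.dvd_one.mp (Nat.modEq_zero_iff_dvd.mp h01.symm))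
  -- the summands agree on squarefree `x^{δ'}`-smooth moduli
  have hcast : ∀ q ∈ (Finset.Icc 1 ⌊x ^ (1 / 2 + 2 * ϖ)⌋₊).filter
      (fun q => Squarefree q ∧ q ∈ Nat.smoothNumbers (N' + 1)),
      ((k : ℤ) : ZMod q) = (a : ZMod q) := by
    intro q hq
    obtain ⟨-, hsq, hsm⟩ := Finset.mem_filter.mp hq
    have hqP : q ∣ P₁ := by
      rw [← Nat.prod_primeFactors_of_squarefree hsq]
      refine Finset.prod_dvd_prod_of_subset _ _ _ fun p hp => ?_
      have hp' := Nat.mem_primeFactors.mp hp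
      exact Finset.mem_filter.mpr
        ⟨Finset.mem_range.mpr ((Nat.mem_smoothNumbers'.mp hsm) p hp'.1 hp'.2.1), hp'.1⟩
    exact (ZMod.intCast_eq_intCast_iff _ _ _).mpr (hka.of_dvd (Int.natCast_dvd_natCast.mpr hqP))
  -- compare the sums
  have hmain := hC x hx (k : ℤ) hk
  calc ∑ q ∈ Icc 1 ⌊x ^ (1 / 2 + 2 * ϖ)⌋₊ with
          Squarefree q ∧ q ∈ Nat.smoothNumbers (N' + 1),
        |ParityWave0.chebyshevPsiMod q (a : ZMod q) (2 * x) -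
            ParityWave0.chebyshevPsiMod q (a : ZMod q) x - x / Nat.totient q|
      = ∑ q ∈ Icc 1 ⌊x ^ (1 / 2 + 2 * ϖ)⌋₊ with
          Squarefree q ∧ q ∈ Nat.smoothNumbers (N' + 1),
        |ParityWave0.chebyshevPsiMod q ((k : ℤ) : ZMod q) (2 * x) -
            ParityWave0.chebyshevPsiMod q ((k : ℤ) : ZMod q) x - x / Nat.totient q| :=
        Finset.sum_congr rfl fun q hq => by rw [hcast q hq]
    _ ≤ ∑ q ∈ Icc 1 ⌊x ^ (1 / 2 + 2 * ϖ)⌋₊ with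
          Squarefree q ∧ q ∈ Nat.smoothNumbers (N + 1),
        |ParityWave0.chebyshevPsiMod q ((k : ℤ) : ZMod q) (2 * x) -
            ParityWave0.chebyshevPsiMod q ((k : ℤ) : ZMod q) x - x / Nat.totient q| := by
        refine Finset.sum_le_sum_of_subset_of_nonneg (fun q hq => ?_) fun q _ _ => abs_nonneg _
        obtain ⟨hqI, hsq, hsm⟩ := Finset.mem_filter.mp hq
        refine Finset.mem_filter.mpr ⟨hqI, hsq, ?_⟩
        exact Nat.mem_smoothNumbers'.mpr fun p hp hpq =>
          lt_of_lt_of_le ((Nat.mem_smoothNumbers'.mp hsm) p hp hpq) (Nat.succ_le_succ hNN)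
    _ ≤ C * x / Real.log x ^ A := hmain

/-! ### Reduction to nonnegative exponents `A` -/

/-- To verify `MPZ[ϖ, δ]` it suffices to treat exponents `A ≥ 0`: for `A < 0` and `x ≥ 2` one has
`(log x)^A ≤ (log 2)^A`, so the bound with `A = 0` implies the bound with exponent `A` after
enlarging the constant by `(log 2)^A`. [folklore] -/
theorem MPZ.of_nonneg {ϖ δ : ℝ}
    (h : ∀ A : ℝ, 0 ≤ A → ∃ C : ℝ, ∀ x : ℝ, 2 ≤ x → ∀ a : ℤ,
      (∀ p : ℕ, p.Prime → p ≤ ⌊x ^ δ⌋₊ → ¬(p : ℤ) ∣ a) →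
      ∑ q ∈ Icc 1 ⌊x ^ (1 / 2 + 2 * ϖ)⌋₊ with
          Squarefree q ∧ q ∈ Nat.smoothNumbers (⌊x ^ δ⌋₊ + 1),
        |ParityWave0.chebyshevPsiMod q (a : ZMod q) (2 * x) -
            ParityWave0.chebyshevPsiMod q (a : ZMod q) x - x / Nat.totient q| ≤
        C * x / Real.log x ^ A) :
    MPZ ϖ δ := by
  intro A
  rcases le_or_gt 0 A with hA | hA
  · exact h A hA
  obtain ⟨C, hC⟩ := h 0 le_rfl
  refine ⟨max C 0 * Real.log 2 ^ A, fun x hx a ha => (hC x hx a ha).trans ?_⟩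
  have hx0 : 0 ≤ x := by linarith
  have hlog2 : 0 < Real.log 2 := Real.log_pos one_lt_two
  have hlogx : Real.log 2 ≤ Real.log x := Real.log_le_log two_pos hx
  have hLx : 0 < Real.log x ^ A := Real.rpow_pos_of_pos (hlog2.trans_le hlogx) A
  have hcmp : Real.log x ^ A ≤ Real.log 2 ^ A := Real.rpow_le_rpow_of_nonpos hlog2 hlogx hA.le
  rw [Real.rpow_zero, div_one, le_div_iff₀ hLx]
  have e1 : C * x * Real.log x ^ A ≤ max C 0 * x * Real.log x ^ A :=
    mul_le_mul_of_nonneg_right (mul_le_mul_of_nonneg_right (le_max_left _ _) hx0) hLx.le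
  have e2 : max C 0 * x * Real.log x ^ A ≤ max C 0 * x * Real.log 2 ^ A :=
    mul_le_mul_of_nonneg_left hcmp (mul_nonneg (le_max_right _ _) hx0)
  calc C * x * Real.log x ^ A ≤ max C 0 * x * Real.log 2 ^ A := e1.trans e2
    _ = max C 0 * Real.log 2 ^ A * x := by ring

/-! ### The Bombieri–Vinogradov range: `MPZ[ϖ, δ]` for `ϖ < 0` -/

/-- A level below `x^{1/2} (log x)^{-B}`: if `(log y)^B ≤ y^{-2ϖ}` and `y > 0` then
`y^{1/2 + 2ϖ} ≤ y^{1/2} / (log y)^B`. [folklore] -/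
theorem MPZ.level_le {y ϖ B : ℝ} (hy : 1 < y) (h : ‖Real.log y ^ B‖ ≤ ‖y ^ (-(2 * ϖ))‖) :
    y ^ (1 / 2 + 2 * ϖ) ≤ y ^ (1 / 2 : ℝ) / Real.log y ^ B := by
  have hy0 : 0 < y := by linarith
  have hLB : 0 < Real.log y ^ B := Real.rpow_pos_of_pos (Real.log_pos hy) B
  rw [Real.norm_of_nonneg hLB.le, Real.norm_of_nonneg (Real.rpow_nonneg hy0.le _)] at h
  rw [le_div_iff₀ hLB]
  calc y ^ (1 / 2 + 2 * ϖ) * Real.log y ^ B ≤ y ^ (1 / 2 + 2 * ϖ) * y ^ (-(2 * ϖ)) :=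
      mul_le_mul_of_nonneg_left h (Real.rpow_nonneg hy0.le _)
    _ = y ^ (1 / 2 : ℝ) := by rw [← Real.rpow_add hy0]; ring_nf

/-- **The Bombieri–Vinogradov range of `MPZ`, core estimate.**  For `-1/4 ≤ ϖ < 0`, any `δ` and any
`A ≥ 0`, the vendored Bombieri–Vinogradov theorem (parity.S27, `bombieri_vinogradov`: for this `A`
there are `B, C` with `∑_{q ≤ X^{1/2}(log X)^{-B}} max_{(b,q)=1} |ψ(y_q; q, b) − y_q/φ(q)| ≤ C X (log X)^{-A}`
for all large `X` and all `y_q ∈ [1, X]`) bounds the `MPZ[ϖ, δ]` sum by `C' x (log x)^{-A}` for ALL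
`x ≥ 2`: for large `x`, `|ψ(2x; q, a) − ψ(x; q, a) − x/φ(q)| ≤ |ψ(2x; q, a) − 2x/φ(q)| + |ψ(x; q, a) − x/φ(q)|`,
each at most the maximum over reduced residues (`(a, q) = 1` because `q` is `x^δ`-smooth and `a` has no
prime factor `≤ x^δ`), the level `x^{1/2+2ϖ}` is eventually below both `x^{1/2}(log x)^{-B}` and
`(2x)^{1/2}(log 2x)^{-B}` (`(log x)^B = o(x^{-2ϖ})`), and Bombieri–Vinogradov is applied at `X = x`,
`y_q = x` and at `X = 2x`, `y_q = 2x`; for bounded `x` the sum is `≤ 15 x · x` trivially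
(`MPZ.abs_summand_le`).  (The Bombieri–Vinogradov theorem enters Polymath 8a as Theorem 2.9; cf.
`eh_of_bombieri_vinogradov` for the same remark on S25.) [cite: Polymath8a2014, Claim 2.3 and Theorem 2.9] -/
theorem MPZ.bound_of_bombieri_vinogradov (hBV : bombieri_vinogradov) {ϖ : ℝ} (hϖ0 : ϖ < 0)
    (hϖ1 : -1 / 4 ≤ ϖ) (δ : ℝ) {A : ℝ} (hA : 0 ≤ A) :
    ∃ C : ℝ, ∀ x : ℝ, 2 ≤ x → ∀ a : ℤ,
      (∀ p : ℕ, p.Prime → p ≤ ⌊x ^ δ⌋₊ → ¬(p : ℤ) ∣ a) →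
      ∑ q ∈ Icc 1 ⌊x ^ (1 / 2 + 2 * ϖ)⌋₊ with
          Squarefree q ∧ q ∈ Nat.smoothNumbers (⌊x ^ δ⌋₊ + 1),
        |ParityWave0.chebyshevPsiMod q (a : ZMod q) (2 * x) -
            ParityWave0.chebyshevPsiMod q (a : ZMod q) x - x / Nat.totient q| ≤
        C * x / Real.log x ^ A := by
  obtain ⟨B, C, hBC⟩ := hBV A
  have h2x : Tendsto (fun x : ℝ => 2 * x) atTop atTop := tendsto_id.const_mul_atTop two_pos
  have hlo : ∀ᶠ x : ℝ in atTop, ‖Real.log x ^ B‖ ≤ ‖x ^ (-(2 * ϖ))‖ :=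
    (isLittleO_log_rpow_rpow_atTop B (by linarith : 0 < -(2 * ϖ))).eventuallyLE
  obtain ⟨x₀, hx₀⟩ := Filter.eventually_atTop.mp
    (hBC.and ((h2x.eventually hBC).and (hlo.and (h2x.eventually hlo))))
  set x₁ : ℝ := max x₀ 2 with hx₁
  have hx₁2 : 2 ≤ x₁ := le_max_right _ _
  have hL₁ : 0 < Real.log x₁ ^ A := Real.rpow_pos_of_pos (Real.log_pos (by linarith)) A
  refine ⟨max (15 * x₁ * Real.log x₁ ^ A) (3 * |C|), fun x hx a ha => ?_⟩
  have hx0 : 0 < x := by linarith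
  have hlogx : 0 < Real.log x := Real.log_pos (by linarith)
  have hLA : 0 < Real.log x ^ A := Real.rpow_pos_of_pos hlogx A
  have hQx : (⌊x ^ (1 / 2 + 2 * ϖ)⌋₊ : ℝ) ≤ x := by
    refine (Nat.floor_le (Real.rpow_nonneg hx0.le _)).trans ?_
    calc x ^ (1 / 2 + 2 * ϖ) ≤ x ^ (1 : ℝ) :=
        Real.rpow_le_rpow_of_exponent_le (by linarith) (by linarith)
      _ = x := Real.rpow_one x
  rcases le_or_gt x x₁ with hsmall | hlarge
  · /- small `x`: the trivial bound -/
    have hterm : ∀ q ∈ (Finset.Icc 1 ⌊x ^ (1 / 2 + 2 * ϖ)⌋₊).filter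
        (fun q => Squarefree q ∧ q ∈ Nat.smoothNumbers (⌊x ^ δ⌋₊ + 1)),
        |ParityWave0.chebyshevPsiMod q (a : ZMod q) (2 * x) -
            ParityWave0.chebyshevPsiMod q (a : ZMod q) x - x / Nat.totient q| ≤ 15 * x :=
      fun q hq => MPZ.abs_summand_le (Finset.mem_Icc.mp (Finset.mem_filter.mp hq).1).1 _ hx0.le
    calc ∑ q ∈ Icc 1 ⌊x ^ (1 / 2 + 2 * ϖ)⌋₊ with
            Squarefree q ∧ q ∈ Nat.smoothNumbers (⌊x ^ δ⌋₊ + 1),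
          |ParityWave0.chebyshevPsiMod q (a : ZMod q) (2 * x) -
              ParityWave0.chebyshevPsiMod q (a : ZMod q) x - x / Nat.totient q|
        ≤ ∑ q ∈ Icc 1 ⌊x ^ (1 / 2 + 2 * ϖ)⌋₊ with
            Squarefree q ∧ q ∈ Nat.smoothNumbers (⌊x ^ δ⌋₊ + 1), 15 * x := Finset.sum_le_sum hterm
      _ = #((Finset.Icc 1 ⌊x ^ (1 / 2 + 2 * ϖ)⌋₊).filter
            (fun q => Squarefree q ∧ q ∈ Nat.smoothNumbers (⌊x ^ δ⌋₊ + 1))) * (15 * x) := by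
          rw [Finset.sum_const, nsmul_eq_mul]
      _ ≤ (⌊x ^ (1 / 2 + 2 * ϖ)⌋₊ : ℝ) * (15 * x) := by
          refine mul_le_mul_of_nonneg_right ?_ (by linarith)
          have := (Finset.card_filter_le (Finset.Icc 1 ⌊x ^ (1 / 2 + 2 * ϖ)⌋₊)
            (fun q => Squarefree q ∧ q ∈ Nat.smoothNumbers (⌊x ^ δ⌋₊ + 1)))
          rw [Nat.card_Icc, Nat.add_sub_cancel] at this
          exact_mod_cast this
      _ ≤ x₁ * (15 * x) := mul_le_mul_of_nonneg_right (hQx.trans hsmall) (by linarith)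
      _ = 15 * x₁ * Real.log x₁ ^ A * x / Real.log x₁ ^ A := by field_simp
      _ ≤ 15 * x₁ * Real.log x₁ ^ A * x / Real.log x ^ A :=
          div_le_div_of_nonneg_left (by positivity) hLA
            (Real.rpow_le_rpow hlogx.le (Real.log_le_log hx0 hsmall) hA)
      _ ≤ max (15 * x₁ * Real.log x₁ ^ A) (3 * |C|) * x / Real.log x ^ A :=
          div_le_div_of_nonneg_right (mul_le_mul_of_nonneg_right (le_max_left _ _) hx0.le) hLA.le
  · /- large `x`: Bombieri–Vinogradov at `x` and at `2x` -/
    obtain ⟨hBVx, hBV2x, hlox, hlo2x⟩ := hx₀ x ((le_max_left _ _).trans hlarge.le)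
    -- Bombieri–Vinogradov with `y_q = x` at `X = x`, and `y_q = 2x` at `X = 2x`
    have h1 : ∑ q ∈ Icc 1 ⌊x ^ (1 / 2 : ℝ) / Real.log x ^ B⌋₊,
        (⨆ b : (ZMod q)ˣ, |ParityWave0.chebyshevPsiMod q b x - x / Nat.totient q|) ≤
          C * x / Real.log x ^ A :=
      hBVx (fun _ => x) fun _ => ⟨by linarith, le_rfl⟩
    have h2 : ∑ q ∈ Icc 1 ⌊(2 * x) ^ (1 / 2 : ℝ) / Real.log (2 * x) ^ B⌋₊,
        (⨆ b : (ZMod q)ˣ, |ParityWave0.chebyshevPsiMod q b (2 * x) - 2 * x / Nat.totient q|) ≤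
          C * (2 * x) / Real.log (2 * x) ^ A :=
      hBV2x (fun _ => 2 * x) fun _ => ⟨by linarith, le_rfl⟩
    -- the levels
    have hlev1 : ⌊x ^ (1 / 2 + 2 * ϖ)⌋₊ ≤ ⌊x ^ (1 / 2 : ℝ) / Real.log x ^ B⌋₊ :=
      Nat.floor_le_floor (MPZ.level_le (by linarith) hlox)
    have hlev2 : ⌊x ^ (1 / 2 + 2 * ϖ)⌋₊ ≤ ⌊(2 * x) ^ (1 / 2 : ℝ) / Real.log (2 * x) ^ B⌋₊ := by
      refine Nat.floor_le_floor (le_trans ?_ (MPZ.level_le (by linarith) hlo2x))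
      exact Real.rpow_le_rpow hx0.le (by linarith) (by linarith)
    -- nonnegativity of the Bombieri–Vinogradov summands
    have hF0 : ∀ (y z : ℝ) (q : ℕ),
        0 ≤ ⨆ b : (ZMod q)ˣ, |ParityWave0.chebyshevPsiMod q b y - z| :=
      fun y z q => Real.iSup_nonneg fun _ => abs_nonneg _
    -- pointwise: triangle inequality and the maximum over reduced residues
    have hterm : ∀ q ∈ (Finset.Icc 1 ⌊x ^ (1 / 2 + 2 * ϖ)⌋₊).filter
        (fun q => Squarefree q ∧ q ∈ Nat.smoothNumbers (⌊x ^ δ⌋₊ + 1)),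
        |ParityWave0.chebyshevPsiMod q (a : ZMod q) (2 * x) -
            ParityWave0.chebyshevPsiMod q (a : ZMod q) x - x / Nat.totient q| ≤
          (⨆ b : (ZMod q)ˣ, |ParityWave0.chebyshevPsiMod q b (2 * x) - 2 * x / Nat.totient q|) +
          (⨆ b : (ZMod q)ˣ, |ParityWave0.chebyshevPsiMod q b x - x / Nat.totient q|) := by
      intro q hq
      obtain ⟨-, -, hsm⟩ := Finset.mem_filter.mp hq
      have hcop : IsCoprime a (q : ℤ) := MPZ.isCoprime_of_smooth ha hsm
      have hsplit : ParityWave0.chebyshevPsiMod q (a : ZMod q) (2 * x) -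
          ParityWave0.chebyshevPsiMod q (a : ZMod q) x - x / Nat.totient q =
          (ParityWave0.chebyshevPsiMod q (a : ZMod q) (2 * x) - 2 * x / Nat.totient q) -
          (ParityWave0.chebyshevPsiMod q (a : ZMod q) x - x / Nat.totient q) := by ring
      rw [hsplit]
      exact (abs_sub _ _).trans (add_le_add (MPZ.abs_sub_le_iSup hcop _ _)
        (MPZ.abs_sub_le_iSup hcop _ _))
    have hlog2x : Real.log x ^ A ≤ Real.log (2 * x) ^ A :=
      Real.rpow_le_rpow hlogx.le (Real.log_le_log hx0 (by linarith)) hA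
    calc ∑ q ∈ Icc 1 ⌊x ^ (1 / 2 + 2 * ϖ)⌋₊ with
            Squarefree q ∧ q ∈ Nat.smoothNumbers (⌊x ^ δ⌋₊ + 1),
          |ParityWave0.chebyshevPsiMod q (a : ZMod q) (2 * x) -
              ParityWave0.chebyshevPsiMod q (a : ZMod q) x - x / Nat.totient q|
        ≤ ∑ q ∈ Icc 1 ⌊x ^ (1 / 2 + 2 * ϖ)⌋₊ with
            Squarefree q ∧ q ∈ Nat.smoothNumbers (⌊x ^ δ⌋₊ + 1),
          ((⨆ b : (ZMod q)ˣ, |ParityWave0.chebyshevPsiMod q b (2 * x) - 2 * x / Nat.totient q|) +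
          (⨆ b : (ZMod q)ˣ, |ParityWave0.chebyshevPsiMod q b x - x / Nat.totient q|)) :=
          Finset.sum_le_sum hterm
      _ ≤ ∑ q ∈ Icc 1 ⌊x ^ (1 / 2 + 2 * ϖ)⌋₊,
          ((⨆ b : (ZMod q)ˣ, |ParityWave0.chebyshevPsiMod q b (2 * x) - 2 * x / Nat.totient q|) +
          (⨆ b : (ZMod q)ˣ, |ParityWave0.chebyshevPsiMod q b x - x / Nat.totient q|)) :=
          Finset.sum_le_sum_of_subset_of_nonneg (Finset.filter_subset _ _)
            fun q _ _ => add_nonneg (hF0 _ _ q) (hF0 _ _ q)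
      _ = ∑ q ∈ Icc 1 ⌊x ^ (1 / 2 + 2 * ϖ)⌋₊,
            (⨆ b : (ZMod q)ˣ, |ParityWave0.chebyshevPsiMod q b (2 * x) - 2 * x / Nat.totient q|) +
          ∑ q ∈ Icc 1 ⌊x ^ (1 / 2 + 2 * ϖ)⌋₊,
            (⨆ b : (ZMod q)ˣ, |ParityWave0.chebyshevPsiMod q b x - x / Nat.totient q|) :=
          Finset.sum_add_distrib
      _ ≤ ∑ q ∈ Icc 1 ⌊(2 * x) ^ (1 / 2 : ℝ) / Real.log (2 * x) ^ B⌋₊,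
            (⨆ b : (ZMod q)ˣ, |ParityWave0.chebyshevPsiMod q b (2 * x) - 2 * x / Nat.totient q|) +
          ∑ q ∈ Icc 1 ⌊x ^ (1 / 2 : ℝ) / Real.log x ^ B⌋₊,
            (⨆ b : (ZMod q)ˣ, |ParityWave0.chebyshevPsiMod q b x - x / Nat.totient q|) :=
          add_le_add
            (Finset.sum_le_sum_of_subset_of_nonneg (Finset.Icc_subset_Icc le_rfl hlev2)
              fun q _ _ => hF0 _ _ q)
            (Finset.sum_le_sum_of_subset_of_nonneg (Finset.Icc_subset_Icc le_rfl hlev1)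
              fun q _ _ => hF0 _ _ q)
      _ ≤ C * (2 * x) / Real.log (2 * x) ^ A + C * x / Real.log x ^ A := add_le_add h2 h1
      _ ≤ |C| * (2 * x) / Real.log (2 * x) ^ A + |C| * x / Real.log x ^ A :=
          add_le_add
            (div_le_div_of_nonneg_right (mul_le_mul_of_nonneg_right (le_abs_self C) (by linarith))
              (hLA.le.trans hlog2x))
            (div_le_div_of_nonneg_right (mul_le_mul_of_nonneg_right (le_abs_self C) hx0.le) hLA.le)
      _ ≤ |C| * (2 * x) / Real.log x ^ A + |C| * x / Real.log x ^ A :=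
          add_le_add (div_le_div_of_nonneg_left (mul_nonneg (abs_nonneg C) (by linarith))
            hLA hlog2x) le_rfl
      _ = 3 * |C| * x / Real.log x ^ A := by ring
      _ ≤ max (15 * x₁ * Real.log x₁ ^ A) (3 * |C|) * x / Real.log x ^ A :=
          div_le_div_of_nonneg_right (mul_le_mul_of_nonneg_right (le_max_right _ _) hx0.le) hLA.le

/-- **`MPZ[ϖ, δ]` in the Bombieri–Vinogradov range, conditional form**: the vendored
Bombieri–Vinogradov theorem parity.S27 (`bombieri_vinogradov`) gives `MPZ[ϖ, δ]` for every `ϖ < 0`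
and every `δ` (first for `max ϖ (−1/4)` by `MPZ.bound_of_bombieri_vinogradov` and `MPZ.of_nonneg`,
then for `ϖ` by `MPZ.mono`).  The level `x^{1/2+2ϖ}`, `ϖ < 0`, is inside the Bombieri–Vinogradov
range `x^{1/2}(log x)^{-B}`; every `ϖ ≥ 0` is beyond it, and there only the smooth-moduli results of
Zhang and Polymath 8a (`mpz_of_lt`, Theorem 2.4) are known. [cite: Polymath8a2014, Claim 2.3, Theorem 2.4 and Theorem 2.9] -/
theorem mpz_of_neg_of_bombieri_vinogradov (hBV : bombieri_vinogradov) {ϖ : ℝ} (hϖ : ϖ < 0)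
    (δ : ℝ) : MPZ ϖ δ := by
  have hcore : MPZ (max ϖ (-1 / 4)) δ :=
    MPZ.of_nonneg fun A hA => MPZ.bound_of_bombieri_vinogradov hBV (max_lt hϖ (by norm_num))
      (le_max_right _ _) δ hA
  exact hcore.mono (le_max_left _ _)

/-- **`MPZ[ϖ, δ]` holds unconditionally for every `ϖ < 0` and every `δ`** — the Bombieri–Vinogradov
range of parity.S29, from the tree's PROVED Bombieri–Vinogradov theorem `bombieri_vinogradov_holds`
(Vaughan's mean value theorem and the Siegel–Walfisz theorem).  The named fact `mpz_of_lt` (Polymath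
8a, Theorem 2.4(i): all `ϖ, δ > 0` with `600ϖ + 180δ < 7`) is exactly the part beyond this range.
[cite: Polymath8a2014, Claim 2.3 and Theorem 2.9][cite: Bombieri1965] -/
theorem mpz_of_neg {ϖ : ℝ} (hϖ : ϖ < 0) (δ : ℝ) : MPZ ϖ δ :=
  mpz_of_neg_of_bombieri_vinogradov bombieri_vinogradov_holds hϖ δ

/-- **The hypothesis `0 < ϖ` in `mpz_of_lt` is redundant**: parity.S29 is equivalent to
`MPZ[ϖ, δ]` for ALL real `ϖ` and all `δ > 0` with `600ϖ + 180δ < 7` — for `ϖ < 0` this is the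
Bombieri–Vinogradov range (`mpz_of_neg`, unconditional), and for `ϖ = 0` it follows from any
`MPZ[ϖ', δ]` with `ϖ' > 0`, `600ϖ' + 180δ < 7` by monotonicity (`MPZ.mono`). [cite: Polymath8a2014, Theorem 2.4(i)] -/
theorem mpz_of_lt_iff_forall :
    mpz_of_lt ↔ ∀ ϖ δ : ℝ, 0 < δ → 600 * ϖ + 180 * δ < 7 → MPZ ϖ δ := by
  refine ⟨fun h ϖ δ hδ hlt => ?_, fun h ϖ δ hϖ hδ hlt => h ϖ δ hδ hlt⟩
  rcases lt_or_ge ϖ 0 with hneg | hnn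
  · exact mpz_of_neg hneg δ
  · -- room above `ϖ`: `ϖ' = ϖ + (7 - 600ϖ - 180δ)/1200 > 0`
    have h' : MPZ (ϖ + (7 - 600 * ϖ - 180 * δ) / 1200) δ :=
      h _ δ (by linarith) hδ (by linarith)
    exact h'.mono (by linarith)

/-! ### The printed main term: `x/φ(q)` versus `(1/φ(q)) ∑_{x < n ≤ 2x, (n,q)=1} Λ(n)` -/

/-- The coprime part of `ψ`: `∑_{n ≤ y, (n,q)=1} Λ(n) = ψ(y) − R(q, y)` with
`R(q, y) = ∑_{n ≤ y, (n,q)>1} Λ(n)` the tree's `nonCoprimePart`. [folklore] -/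
theorem MPZ.sum_coprime_vonMangoldt_eq (q : ℕ) (y : ℝ) :
    ∑ n ∈ range (⌊y⌋₊ + 1) with n.Coprime q, Λ n = Chebyshev.psi y - nonCoprimePart q y := by
  rw [eq_sub_iff_add_eq, nonCoprimePart, Finset.sum_filter_add_sum_filter_not,
    Chebyshev.psi_eq_sum_Icc, Nat.range_succ_eq_Icc_zero]

/-- `(log x)^m ≤ m^m x` for `x ≥ 1`, `m > 0` (from Mathlib's `log x ≤ x^ε/ε` at `ε = 1/m`).
[folklore] -/
theorem MPZ.log_rpow_le {x m : ℝ} (hx : 1 ≤ x) (hm : 0 < m) : Real.log x ^ m ≤ m ^ m * x := by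
  have hx0 : 0 ≤ x := zero_le_one.trans hx
  have h1 : Real.log x ≤ m * x ^ (1 / m) := by
    have := Real.log_le_rpow_div hx0 (one_div_pos.mpr hm)
    rw [div_eq_mul_one_div, one_div_one_div, mul_comm] at this
    exact this
  calc Real.log x ^ m ≤ (m * x ^ (1 / m)) ^ m :=
      Real.rpow_le_rpow (Real.log_nonneg hx) h1 hm.le
    _ = m ^ m * x := by
      rw [Real.mul_rpow hm.le (Real.rpow_nonneg hx0 _), ← Real.rpow_mul hx0,
        one_div_mul_cancel hm.ne', Real.rpow_one]

/-- Comparing powers of `log x` with different exponents on `x ≥ 2`: for `A ≤ A'`,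
`(log x)^A ≤ (log 2)^{A − A'} (log x)^{A'}` (the factor `(log x)^{A−A'}` is largest at `x = 2`).
[folklore] -/
theorem MPZ.log_rpow_le_mul_log_rpow {x A A' : ℝ} (hx : 2 ≤ x) (hA : A ≤ A') :
    Real.log x ^ A ≤ Real.log 2 ^ (A - A') * Real.log x ^ A' := by
  have hlog2 : 0 < Real.log 2 := Real.log_pos one_lt_two
  have hle : Real.log 2 ≤ Real.log x := Real.log_le_log two_pos hx
  have hlogx : 0 < Real.log x := hlog2.trans_le hle
  calc Real.log x ^ A = Real.log x ^ (A - A') * Real.log x ^ A' := by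
        rw [← Real.rpow_add hlogx, sub_add_cancel]
    _ ≤ Real.log 2 ^ (A - A') * Real.log x ^ A' :=
        mul_le_mul_of_nonneg_right (Real.rpow_le_rpow_of_nonpos hlog2 hle (by linarith))
          (Real.rpow_nonneg hlogx.le _)

/-- **The two main terms of `MPZ` differ by an admissible error.**  For `ϖ ≤ 1/4` and every real
`A` there is `K` such that for all `x ≥ 2`,
`∑_{q ≤ x^{1/2+2ϖ}} |(1/φ(q)) ∑_{x < n ≤ 2x, (n,q)=1} Λ(n) − x/φ(q)| ≤ K x (log x)^{-A}`:
per modulus the difference is at most `(1/φ(q)) (|ψ(2x) − 2x| + |ψ(x) − x| + R(q, 2x))` with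
`R(q, 2x) ≤ (log 2x/log 2) log q` (`nonCoprimePart_le`: only prime powers `p^k` with `p ∣ q`
contribute), `∑_{q ≤ Q} 1/φ(q) ≤ (1 + log Q)²` (`totientInvSum_le`), and
`|ψ(y) − y| ≤ C y (log y)^{−A−2}` is the prime number theorem with the de la Vallée Poussin error term
(`ChebyshevPsiDeLaValleePoussin_holds.logPow`). [folklore] -/
theorem MPZ.sum_abs_mainTerm_sub_le {ϖ : ℝ} (hϖ : ϖ ≤ 1 / 4) (A : ℝ) :
    ∃ K : ℝ, ∀ x : ℝ, 2 ≤ x →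
      ∑ q ∈ Icc 1 ⌊x ^ (1 / 2 + 2 * ϖ)⌋₊,
        |((∑ n ∈ range (⌊2 * x⌋₊ + 1) with n.Coprime q, Λ n) -
            ∑ n ∈ range (⌊x⌋₊ + 1) with n.Coprime q, Λ n) / Nat.totient q - x / Nat.totient q| ≤
      K * x / Real.log x ^ A := by
  set A' : ℝ := max A 0 with hA'
  have hA'0 : 0 ≤ A' := le_max_right _ _
  have hAA' : A ≤ A' := le_max_left _ _
  obtain ⟨C, hC⟩ := LFunctions.ChebyshevPsiDeLaValleePoussin_holds.logPow (A' + 2)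
  set C₀ : ℝ := max C 0 with hC₀
  set κ : ℝ := Real.log 2 ^ (A - A') with hκ
  set m : ℝ := 4 + A' with hm
  have hm0 : 0 < m := by linarith
  have hκ0 : 0 < κ := Real.rpow_pos_of_pos (Real.log_pos one_lt_two) _
  refine ⟨(27 * C₀ + 36 * m ^ m) * κ, fun x hx => ?_⟩
  -- basic positivity
  have hx0 : 0 < x := by linarith
  have hx1 : 1 ≤ x := by linarith
  have hlog2 : (1 : ℝ) / 2 < Real.log 2 := by have := Real.log_two_gt_d9; linarith
  have ht : 0 < Real.log x := Real.log_pos (by linarith)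
  have ht2 : Real.log 2 ≤ Real.log x := Real.log_le_log two_pos hx
  have htA : 0 < Real.log x ^ A := Real.rpow_pos_of_pos ht A
  have htA' : 0 < Real.log x ^ A' := Real.rpow_pos_of_pos ht A'
  have hlog2x : Real.log (2 * x) ≤ 2 * Real.log x := by
    rw [Real.log_mul two_ne_zero hx0.ne', two_mul]; exact add_le_add ht2 le_rfl
  -- the level `Q ≤ x`
  set Q : ℕ := ⌊x ^ (1 / 2 + 2 * ϖ)⌋₊ with hQ
  have hQx : (Q : ℝ) ≤ x := by
    refine (Nat.floor_le (Real.rpow_nonneg hx0.le _)).trans ?_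
    calc x ^ (1 / 2 + 2 * ϖ) ≤ x ^ (1 : ℝ) :=
        Real.rpow_le_rpow_of_exponent_le hx1 (by linarith)
      _ = x := Real.rpow_one x
  have hlogQ : Real.log Q ≤ Real.log x := by
    rcases Nat.eq_zero_or_pos Q with hQ0 | hQpos
    · rw [hQ0, Nat.cast_zero, Real.log_zero]; exact ht.le
    · exact Real.log_le_log (by exact_mod_cast hQpos) hQx
  -- the prime number theorem at `x` and `2x`
  have hE1 : |Chebyshev.psi x - x| ≤ C₀ * x / Real.log x ^ (A' + 2) :=
    (hC x hx).trans (div_le_div_of_nonneg_right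
      (mul_le_mul_of_nonneg_right (le_max_left _ _) hx0.le) (Real.rpow_pos_of_pos ht _).le)
  have hE2 : |Chebyshev.psi (2 * x) - 2 * x| ≤ 2 * C₀ * x / Real.log x ^ (A' + 2) := by
    have h := hC (2 * x) (by linarith)
    have hlt : Real.log x ^ (A' + 2) ≤ Real.log (2 * x) ^ (A' + 2) :=
      Real.rpow_le_rpow ht.le (Real.log_le_log hx0 (by linarith)) (by linarith)
    calc |Chebyshev.psi (2 * x) - 2 * x| ≤ C * (2 * x) / Real.log (2 * x) ^ (A' + 2) := h
      _ ≤ C₀ * (2 * x) / Real.log (2 * x) ^ (A' + 2) :=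
          div_le_div_of_nonneg_right (mul_le_mul_of_nonneg_right (le_max_left _ _) (by linarith))
            ((Real.rpow_pos_of_pos ht _).le.trans hlt)
      _ ≤ C₀ * (2 * x) / Real.log x ^ (A' + 2) :=
          div_le_div_of_nonneg_left (mul_nonneg (le_max_right _ _) (by linarith))
            (Real.rpow_pos_of_pos ht _) hlt
      _ = 2 * C₀ * x / Real.log x ^ (A' + 2) := by ring
  -- the uniform bound `M` for `|ψ(2x) − 2x| + |ψ(x) − x| + R(q, 2x)`, `q ≤ Q`
  set M : ℝ := 3 * C₀ * x / Real.log x ^ (A' + 2) + 4 * Real.log x ^ 2 with hM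
  have hM0 : 0 ≤ M := by positivity
  have hterm : ∀ q ∈ Icc 1 Q,
      |((∑ n ∈ range (⌊2 * x⌋₊ + 1) with n.Coprime q, Λ n) -
          ∑ n ∈ range (⌊x⌋₊ + 1) with n.Coprime q, Λ n) / Nat.totient q - x / Nat.totient q| ≤
        M * ((Nat.totient q : ℝ))⁻¹ := by
    intro q hq
    obtain ⟨hq1, hqQ⟩ := Finset.mem_Icc.mp hq
    have hφ : (0 : ℝ) < Nat.totient q := by exact_mod_cast Nat.totient_pos.mpr hq1
    have hR0 : 0 ≤ nonCoprimePart q x := nonCoprimePart_nonneg q x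
    have hRmono : nonCoprimePart q x ≤ nonCoprimePart q (2 * x) := nonCoprimePart_mono q (by linarith)
    have hR : nonCoprimePart q (2 * x) ≤ 4 * Real.log x ^ 2 := by
      have h1 := nonCoprimePart_le (Nat.one_le_iff_ne_zero.mp hq1) (by linarith : (0 : ℝ) ≤ 2 * x)
      have hlogq : Real.log q ≤ Real.log x :=
        (Real.log_le_log (by exact_mod_cast hq1) (by exact_mod_cast hqQ)).trans hlogQ
      have hlogq0 : 0 ≤ Real.log q := Real.log_natCast_nonneg q
      have hfl : (⌊Real.log (2 * x) / Real.log 2⌋₊ : ℝ) ≤ Real.log (2 * x) / Real.log 2 :=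
        Nat.floor_le (div_nonneg (Real.log_nonneg (by linarith)) (by linarith))
      have hquot : Real.log (2 * x) / Real.log 2 ≤ 4 * Real.log x := by
        rw [div_le_iff₀ (by linarith)]; nlinarith
      calc nonCoprimePart q (2 * x) ≤ ⌊Real.log (2 * x) / Real.log 2⌋₊ * Real.log q := h1
        _ ≤ 4 * Real.log x * Real.log x :=
            mul_le_mul (hfl.trans hquot) hlogq hlogq0 (by positivity)
        _ = 4 * Real.log x ^ 2 := by ring
    rw [MPZ.sum_coprime_vonMangoldt_eq, MPZ.sum_coprime_vonMangoldt_eq, ← sub_div, abs_div,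
      abs_of_pos hφ, div_eq_mul_inv]
    refine mul_le_mul_of_nonneg_right ?_ (inv_nonneg.mpr hφ.le)
    have hsplit : Chebyshev.psi (2 * x) - nonCoprimePart q (2 * x) -
        (Chebyshev.psi x - nonCoprimePart q x) - x =
        (Chebyshev.psi (2 * x) - 2 * x) - (Chebyshev.psi x - x) -
          (nonCoprimePart q (2 * x) - nonCoprimePart q x) := by ring
    rw [hsplit]
    have hRdiff : |nonCoprimePart q (2 * x) - nonCoprimePart q x| ≤ 4 * Real.log x ^ 2 := by
      rw [abs_of_nonneg (by linarith)]; linarith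
    calc |Chebyshev.psi (2 * x) - 2 * x - (Chebyshev.psi x - x) -
            (nonCoprimePart q (2 * x) - nonCoprimePart q x)|
        ≤ |Chebyshev.psi (2 * x) - 2 * x - (Chebyshev.psi x - x)| +
            |nonCoprimePart q (2 * x) - nonCoprimePart q x| := abs_sub _ _
      _ ≤ (|Chebyshev.psi (2 * x) - 2 * x| + |Chebyshev.psi x - x|) +
            |nonCoprimePart q (2 * x) - nonCoprimePart q x| :=
          add_le_add (abs_sub _ _) le_rfl
      _ ≤ (2 * C₀ * x / Real.log x ^ (A' + 2) + C₀ * x / Real.log x ^ (A' + 2)) +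
            4 * Real.log x ^ 2 := add_le_add (add_le_add hE2 hE1) hRdiff
      _ = M := by rw [hM]; ring
  -- summing `1/φ(q)`
  have hW : ∑ q ∈ Icc 1 Q, ((Nat.totient q : ℝ))⁻¹ ≤ 9 * Real.log x ^ 2 := by
    have h1 : totientInvSum Q ≤ (1 + Real.log Q) ^ 2 := totientInvSum_le Q
    have h2 : (1 + Real.log Q) ^ 2 ≤ (3 * Real.log x) ^ 2 := by
      have hQ0 : 0 ≤ Real.log (Q : ℝ) := Real.log_natCast_nonneg Q
      exact pow_le_pow_left₀ (by linarith) (by linarith) 2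
    calc ∑ q ∈ Icc 1 Q, ((Nat.totient q : ℝ))⁻¹ = totientInvSum Q := rfl
      _ ≤ 9 * Real.log x ^ 2 := by linarith [h1, h2]
  -- assembling
  have hsum : ∑ q ∈ Icc 1 Q,
      |((∑ n ∈ range (⌊2 * x⌋₊ + 1) with n.Coprime q, Λ n) -
          ∑ n ∈ range (⌊x⌋₊ + 1) with n.Coprime q, Λ n) / Nat.totient q - x / Nat.totient q| ≤
        M * (9 * Real.log x ^ 2) :=
    calc _ ≤ ∑ q ∈ Icc 1 Q, M * ((Nat.totient q : ℝ))⁻¹ := Finset.sum_le_sum hterm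
      _ = M * ∑ q ∈ Icc 1 Q, ((Nat.totient q : ℝ))⁻¹ := by rw [Finset.mul_sum]
      _ ≤ M * (9 * Real.log x ^ 2) := mul_le_mul_of_nonneg_left hW hM0
  refine hsum.trans ?_
  -- `M · 9 log² x = 27 C₀ x / log^{A'} x + 36 log⁴ x ≤ K x / log^A x`
  have hB : Real.log x ^ (A' + 2) = Real.log x ^ A' * Real.log x ^ 2 := by
    rw [Real.rpow_add ht, Real.rpow_two]
  have hcmp : Real.log x ^ A ≤ κ * Real.log x ^ A' := MPZ.log_rpow_le_mul_log_rpow hx hAA'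
  have h4 : Real.log x ^ 4 * Real.log x ^ A' ≤ m ^ m * x := by
    have e : Real.log x ^ 4 * Real.log x ^ A' = Real.log x ^ m := by
      rw [hm, Real.rpow_add ht, ← Real.rpow_natCast _ 4]; norm_num
    rw [e]; exact MPZ.log_rpow_le hx1 hm0
  rw [le_div_iff₀ htA]
  calc M * (9 * Real.log x ^ 2) * Real.log x ^ A
      ≤ M * (9 * Real.log x ^ 2) * (κ * Real.log x ^ A') :=
        mul_le_mul_of_nonneg_left hcmp (by positivity)
    _ = κ * (27 * C₀ * x * (Real.log x ^ A' * Real.log x ^ 2) / Real.log x ^ (A' + 2)) +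
          κ * (36 * (Real.log x ^ 4 * Real.log x ^ A')) := by rw [hM]; ring
    _ = κ * (27 * C₀ * x) + κ * (36 * (Real.log x ^ 4 * Real.log x ^ A')) := by
        rw [← hB, mul_div_assoc, div_self (Real.rpow_pos_of_pos ht _).ne', mul_one]
    _ ≤ κ * (27 * C₀ * x) + κ * (36 * (m ^ m * x)) := by
        have := mul_le_mul_of_nonneg_left h4 (by positivity : (0 : ℝ) ≤ κ * 36)
        linarith
    _ = (27 * C₀ + 36 * m ^ m) * κ * x := by ring

/-- **The vendored main term `x/φ(q)` and Polymath's `(1/φ(q)) ∑_{x < n ≤ 2x, (n,q)=1} Λ(n)` give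
equivalent `MPZ[ϖ, δ]`** (for `ϖ ≤ 1/4`, which contains every admissible `ϖ < 1/4` of Claim 2.3): the
two sums of absolute discrepancies differ by at most the admissible error of
`MPZ.sum_abs_mainTerm_sub_le` (prime number theorem with error `x (log x)^{-A-2}`, `∑ 1/φ(q) ≪ log² x`,
prime powers `p^k`, `p ∣ q`, negligible), in either direction.  This is faithfulness point (c) of the
docstring of `MPZ`: Polymath 8a, Claim 2.3, measures `Δ(Λ 1_{[x,2x]}; a (q))` against the coprime
mean (§1.3, the signed discrepancy `Δ(α; a (q)) := ∑_{n = a (q)} α(n) − (1/φ(q)) ∑_{(n,q)=1} α(n)`),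
here over `x < n ≤ 2x`. [cite: Polymath8a2014, Claim 2.3 and §1.3 (discrepancy)] -/
theorem MPZ_iff_coprimeMean {ϖ δ : ℝ} (hϖ : ϖ ≤ 1 / 4) :
    MPZ ϖ δ ↔
    ∀ A : ℝ, ∃ C : ℝ, ∀ x : ℝ, 2 ≤ x → ∀ a : ℤ,
      (∀ p : ℕ, p.Prime → p ≤ ⌊x ^ δ⌋₊ → ¬(p : ℤ) ∣ a) →
      ∑ q ∈ Icc 1 ⌊x ^ (1 / 2 + 2 * ϖ)⌋₊ with
          Squarefree q ∧ q ∈ Nat.smoothNumbers (⌊x ^ δ⌋₊ + 1),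
        |ParityWave0.chebyshevPsiMod q (a : ZMod q) (2 * x) -
            ParityWave0.chebyshevPsiMod q (a : ZMod q) x -
          ((∑ n ∈ range (⌊2 * x⌋₊ + 1) with n.Coprime q, Λ n) -
            ∑ n ∈ range (⌊x⌋₊ + 1) with n.Coprime q, Λ n) / Nat.totient q| ≤
        C * x / Real.log x ^ A := by
  constructor
  · intro h A
    obtain ⟨C, hC⟩ := h A
    obtain ⟨K, hK⟩ := MPZ.sum_abs_mainTerm_sub_le hϖ A
    refine ⟨C + K, fun x hx a ha => ?_⟩
    have h1 := hC x hx a ha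
    have h2 := hK x hx
    calc _ ≤ ∑ q ∈ Icc 1 ⌊x ^ (1 / 2 + 2 * ϖ)⌋₊ with
            Squarefree q ∧ q ∈ Nat.smoothNumbers (⌊x ^ δ⌋₊ + 1),
          (|ParityWave0.chebyshevPsiMod q (a : ZMod q) (2 * x) -
              ParityWave0.chebyshevPsiMod q (a : ZMod q) x - x / Nat.totient q| +
           |((∑ n ∈ range (⌊2 * x⌋₊ + 1) with n.Coprime q, Λ n) -
              ∑ n ∈ range (⌊x⌋₊ + 1) with n.Coprime q, Λ n) / Nat.totient q - x / Nat.totient q|) := by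
          refine Finset.sum_le_sum fun q _ => ?_
          refine le_trans (le_of_eq ?_) (abs_sub _ _)
          congr 1; ring
      _ ≤ C * x / Real.log x ^ A + K * x / Real.log x ^ A := by
          rw [Finset.sum_add_distrib]
          refine add_le_add h1 (le_trans ?_ h2)
          exact Finset.sum_le_sum_of_subset_of_nonneg (Finset.filter_subset _ _)
            fun q _ _ => abs_nonneg _
      _ = (C + K) * x / Real.log x ^ A := by ring
  · intro h A
    obtain ⟨C, hC⟩ := h A
    obtain ⟨K, hK⟩ := MPZ.sum_abs_mainTerm_sub_le hϖ A
    refine ⟨C + K, fun x hx a ha => ?_⟩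
    have h1 := hC x hx a ha
    have h2 := hK x hx
    calc _ ≤ ∑ q ∈ Icc 1 ⌊x ^ (1 / 2 + 2 * ϖ)⌋₊ with
            Squarefree q ∧ q ∈ Nat.smoothNumbers (⌊x ^ δ⌋₊ + 1),
          (|ParityWave0.chebyshevPsiMod q (a : ZMod q) (2 * x) -
              ParityWave0.chebyshevPsiMod q (a : ZMod q) x -
              ((∑ n ∈ range (⌊2 * x⌋₊ + 1) with n.Coprime q, Λ n) -
                ∑ n ∈ range (⌊x⌋₊ + 1) with n.Coprime q, Λ n) / Nat.totient q| +
           |((∑ n ∈ range (⌊2 * x⌋₊ + 1) with n.Coprime q, Λ n) -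
              ∑ n ∈ range (⌊x⌋₊ + 1) with n.Coprime q, Λ n) / Nat.totient q - x / Nat.totient q|) := by
          refine Finset.sum_le_sum fun q _ => ?_
          refine le_trans (le_of_eq ?_) (abs_add_le _ _)
          congr 1; ring
      _ ≤ C * x / Real.log x ^ A + K * x / Real.log x ^ A := by
          rw [Finset.sum_add_distrib]
          refine add_le_add h1 (le_trans ?_ h2)
          exact Finset.sum_le_sum_of_subset_of_nonneg (Finset.filter_subset _ _)
            fun q _ _ => abs_nonneg _
      _ = (C + K) * x / Real.log x ^ A := by ring

end Literature.NumberTheory.Sieve
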